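import Summits.QuantumFields.BalabanUV.T4Continuum.Support.NE7TopDbarFieldAtPair
import Summits.QuantumFields.BalabanUV.T4Continuum.Support.NE3TangentCovariantStructure
import Summits.QuantumFields.BalabanUV.T4Continuum.Support.NE3GaugeDirFrames
import Summits.QuantumFields.BalabanUV.T4Continuum.Support.AveragingDeficitMultiLevelBridge
import HarnessLib

/-!
# Support | NE7 (gen 97, ROAD-G96 §9∕§11, third brick of (Γ3), part 1 — THE DICTIONARY): `framePotW L k W X z = Σ_{m<k} frameLin L W̄^m (QbarIter L m W X) (L^{k−m}•z)`
# (the tree's accumulated linear frame IS the level sum, along the nested corner chain, of the linearised block frames of the linearised double-bar fields) and, in the regime of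
# [Balaban1985Averaging] Prop. 4, the LEVEL DICTIONARY `U̿^m = e^{Ad_{W̄^m}ψ_m}`, `ψ_m − QbarIter_m X = Ad_{W̄^m}⁻¹(Q_m − L^mQ_m)`, `‖ψ_m‖ ≤ 2L^m b`, `‖ψ_m − QbarIter_m X‖ ≤ 16C₁(L^m b)²`

Cell `pub-balaban`, rung (B)+1 sub-cell t4, lineage `b2b-balaban-t4-ne7-p1` (CRUX PROVER NE7 #1 = OWNER of row NE7), generation 97; memo `t4/b2b-balaban-t4-ne7-p1-g96/ROAD-G96.md`
§9 (Γ3) ∕ §11 addendum («WHAT (Γ3) STILL NEEDS: (i) the dictionary `Σ_m frameLin_m(logCovIter_m) ↔ framePotW` (tree: `NE3TangentCovariantTower.framePotW_succ`, `QbarTowerB8.linCovIter_adField`;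
the nonlinear level fields `logCovIter_m` differ from `linCovIter_m` by NE3's tower remainders)»).  Over [Balaban1985Averaging] Prop. 4 at every level (`B7Eq123General.prop4_general`:
`‖Q_m − L^mQ_m‖ ≤ 8C₁e^{4cα₀}(L^m b)²`, `‖Q_m‖ ≤ 2L^m b`, `C₁ = 131072(d+1)²`, `c = 800(d+1)²(d+4)`; `level_data`, `B7Prop4GeneralLevels.level_regularity`,
`dbavgCovIter_eq_expCfg_logCovIter`), row NE3's dictionary `QbarTowerB8.linCovIter_adField`, and the tree's recursion `NE3TangentCovariantTower.framePotW_succ'`.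

WHY (memo §7(a), §10, §11).  ROAD-Γ removes the exact top pure gauge of the accumulated frame `v_{k+1}` ((Γ1)∘(Γ2): `NE7QbarTopSplitAtPair`) by a gauge adjustment at the top
corners; its residues are bounded through `log v_{k+1}(z)`, whose FIRST-ORDER part in the competitor's field `X` must be identified with a tree object — it is the accumulated
linear frame `framePotW L (k+1) W X z` (zero on the slice `T_♮` = `frameFreeBlockLandauW`, an honest block-average reading in general).  THIS FILE is that identification, level
by level: `v_{k+1}(z) = Π_m exp Fcov_m(L^{k+1−m}z)` (`NE7AccumulatedFrameSecondOrder.exists_list_vcov`) is matched term by term with `framePotW = Σ_m frameLin_m(QbarIter_m)(L^{k+1−m}z)`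
(§1), and at each level the double-bar configuration `U̿^m` is `expCfg (Ad_{W̄^m}ψ_m)` with `ψ_m` within the Prop-4 remainder of the LINEAR field `QbarIter L m W X` (§2) — the
shape `NE7BlockFrameSecondOrder.norm_Fcov_sub_frameLin_le` consumes.  Part 2 (`NE7AccumulatedFrameLinearisation`) assembles the sup form `‖log v_k − framePotW‖ ≤ C(L^k b)²`.
WHAT ([folklore]; 0 def, 0 sorry).  §1 `Ad_sub`, `sum_pow_le_pow` (`Σ_{m<k} r^m ≤ r^k`, `r ≥ 2`), `frameLin_sub`, `norm_frameLin_le_of_sup` (`‖frameLin L V R y‖ ≤ dL·sup‖R‖` at a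
unitary `V`), **`framePotW_eq_sum_frameLin`** (the dictionary, induction on `framePotW_succ'`).  §2 `exp_le_two_of_hsmall`, **`level_dictionary`** — in the Prop-4 regime at
level `k` (hypotheses of `dbavgCovIter_eq_expCfg_logCovIter`, `W` unitary, `sup‖X‖ ≤ b`), for every `m ≤ k`, with `W̄^m = avgIter L W m`, `ψ_m = Ad_{W̄^m}⁻¹ logCovIter L W (Ad_W X) m`:
(i) `W̄^m` unitary; (ii) `dbavgCovIter L W (relPert W X) m = expCfg (Ad_{W̄^m} ψ_m)`; (iii) `ψ_m − QbarIter L m W X = Ad_{W̄^m}⁻¹(logCovIter_m − linCovIter_m)` bondwise;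
(iv) `‖ψ_m‖ ≤ 2L^m b`; (v) `‖ψ_m − QbarIter L m W X‖ ≤ 16C₁(L^m b)²`.
HONEST FRAMING (page 1): lattice kinematics∕bookkeeping on OUR frame over landed kernel theorems; nothing of Bałaban's asserted; (Γ3)'s letters, (Γ4), `hdecomp♭`, NE7 NOT proved;
spine 0∕9; finite T⁴ rung (B)+1 — NOT infinite volume, NOT mass gap, NOT `BetaPertH`, NOT Clay.  Continuum YM on T⁴ ⇐ BetaPertH ∧ nine spine estimates (0/9 proved); BetaPertH ⇐
(D1) ∧ (D4) ∧ CAP+tail; G-an2-4 gates asym, D1 and NE2/3/4.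
-/

set_option autoImplicit false

open scoped BigOperators Matrix Matrix.Norms.L2Operator
open NormedSpace Finset

namespace Summit.QuantumFields.BalabanUV.T4Continuum.NE7AccumulatedFrameDictionary

open Literature.MathematicalPhysics.QuantumFieldTheory.Balaban1983to89
open B7Prop1Explicit B7Prop2Explicit B7Prop3Flat MatrixLog
open B7Eq92Concrete (dbavgCovIter)
open B7Prop4GeneralLevels (logCovIter linCovIter)
open B7Eq123General (prop4_general level_data blockLoops_of_pdev dbavgCovIter_eq_expCfg_logCovIter)
open T4AveragingDeficitWall (Ad IsUnitaryCfg)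
open T4AveragingDeficitNonAbelian (Ad_mul)
open AveragingDeficitTransport (dhol lnorm lnorm_cons norm_dhol_le norm_Ad_of_unitary)
open AveragingDeficitNearIdentity (Ad_add Ad_neg Ad_one)
open AveragingDeficitMultiLevelPrep (cavgIter)
open AveragingDeficitMultiLevelBridge (cavgIter_eq_avgIter)
open BlockAveragePushDirSplit (frameLin)
open NE3TangentCovariantStructure (Fbar frameLin_add)
open NE3TangentCovariantTower (QbarIter framePotW framePotW_zero framePotW_succ')
open NE3.QbarDictionary (adField relPert_eq_expCfg_adField)
open NE3.PairLandauB8Avg (relPert)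
open NE3.QbarTowerB8 (linCovIter_adField)
open NE3GaugeDirFrames (Ad_Ad_inv)

noncomputable section

variable {d : ℕ} {n : Type*} [Fintype n] [DecidableEq n]

/-! ## §1 Elementary letters and the dictionary `framePotW = Σ_m frameLin_m(QbarIter_m)` -/

/-- `Ad` respects subtraction. [folklore] -/
theorem Ad_sub (u : (Matrix n n ℂ)ˣ) (A B : Matrix n n ℂ) : Ad u (A - B) = Ad u A - Ad u B := by
  rw [sub_eq_add_neg, Ad_add, Ad_neg, ← sub_eq_add_neg]

/-- Geometric sums with ratio at least two: `Σ_{m<k} r^m ≤ r^k`. [folklore] -/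
theorem sum_pow_le_pow {r : ℝ} (hr : 2 ≤ r) : ∀ k : ℕ, ∑ m ∈ range k, r ^ m ≤ r ^ k
  | 0 => by simp
  | k + 1 => by
      rw [Finset.sum_range_succ, pow_succ]
      have ih := sum_pow_le_pow hr k
      have h0 : 0 ≤ r ^ k := pow_nonneg (by linarith) k
      nlinarith

/-- `frameLin` is additive, subtraction form: `frameLin L V A y − frameLin L V B y = frameLin L V (A − B) y`. [folklore] -/
theorem frameLin_sub (L : ℕ) (V : Site d → Fin d → (Matrix n n ℂ)ˣ) (A B : Site d → Fin d → Matrix n n ℂ) (y : Site d) :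
    frameLin L V A y - frameLin L V B y = frameLin L V (A - B) y := by
  have h := frameLin_add L V (A - B) B y
  have e : (fun x μ => (A - B) x μ + B x μ) = A := by
    funext x μ; simp
  rw [e] at h
  rw [h, add_sub_cancel_right]

/-- **SUP LETTER OF THE LINEARISED BLOCK FRAME**: at a unitary `V`, `‖R‖ ≤ s` bondwise ⟹ `‖frameLin L V R y‖ ≤ d·L·s` (every tree contour of the block has at most `dL`
bonds; `‖δ_R V(Γ)‖ ≤ Σ_{b⊂Γ}‖R_b‖`). [folklore] -/
theorem norm_frameLin_le_of_sup {L : ℕ} (hL : 1 ≤ L) {V : Site d → Fin d → (Matrix n n ℂ)ˣ} (hV : IsUnitaryCfg V)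
    {R : Site d → Fin d → Matrix n n ℂ} {s : ℝ} (hs : 0 ≤ s) (hR : ∀ (x : Site d) (κ : Fin d), ‖R x κ‖ ≤ s) (y : Site d) :
    ‖frameLin L V R y‖ ≤ (d : ℝ) * L * s := by
  letI : CStarAlgebra (Matrix n n ℂ) := {}
  -- `lnorm` along a word is at most `|word|·s`
  have hlen : ∀ (w : List (Letter d)) (x : Site d), lnorm R x w ≤ w.length * s := by
    intro w
    induction w with
    | nil => intro x; simp
    | cons l w ih =>
        intro x
        rw [lnorm_cons, List.length_cons, Nat.cast_succ]
        have := hR (if l.2 then x else x + l.vec) l.1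
        have := ih (x + l.vec)
        linarith
  have htree : ∀ r : Fin d → Fin L, ‖dhol V R y (treeWord (boxVec L r))‖ ≤ (d : ℝ) * L * s := by
    intro r
    refine ((norm_dhol_le hV R y _).trans (hlen _ y)).trans ?_
    have h := l1_boxVec_le L r
    rw [← length_treeWord] at h
    have : ((treeWord (boxVec L r)).length : ℝ) ≤ (d : ℝ) * L := by exact_mod_cast h
    nlinarith
  have hcard : (Finset.univ : Finset (Fin d → Fin L)).card = L ^ d := by simp
  have hLd : (0 : ℝ) < (L : ℝ) ^ d := pow_pos (by exact_mod_cast (by omega : 0 < L)) d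
  unfold frameLin
  calc ‖∑ r : Fin d → Fin L, (((L : ℝ) ^ d)⁻¹) • dhol V R y (treeWord (boxVec L r))‖
      ≤ ∑ r : Fin d → Fin L, ((L : ℝ) ^ d)⁻¹ * ((d : ℝ) * L * s) := by
        refine (norm_sum_le _ _).trans (Finset.sum_le_sum fun r _ => ?_)
        rw [norm_smul, norm_inv, norm_pow, Real.norm_natCast]
        exact mul_le_mul_of_nonneg_left (htree r) (by positivity)
    _ = (d : ℝ) * L * s := by
        rw [Finset.sum_const, hcard, nsmul_eq_mul]; push_cast; field_simp

/-- **THE DICTIONARY**: the tree's accumulated linear frame of the `k`-fold average is the level sum of the linearised block frames of the linearised double-bar fields,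
read along the nested corner chain: `framePotW L k W Y z = Σ_{m<k} frameLin L (W̄^m) (QbarIter L m W Y) (L^{k−m}•z)`, `W̄^m = cavgIter L m W` (induction on
`framePotW_succ'`: `framePotW (j+1) W Y z = Fbar (W̄^j) (QbarIter j Y) z + framePotW j W Y (L•z)`; the same product structure as `vcov_succ`). [folklore] -/
theorem framePotW_eq_sum_frameLin (L : ℕ) (W : Site d → Fin d → (Matrix n n ℂ)ˣ) (Y : Site d → Fin d → Matrix n n ℂ) :
    ∀ (k : ℕ) (z : Site d), framePotW L k W Y z
      = ∑ m ∈ range k, frameLin L (cavgIter L m W) (QbarIter L m W Y) (((L : ℤ) ^ (k - m)) • z)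
  | 0, z => by rw [framePotW_zero]; simp
  | k + 1, z => by
      rw [framePotW_succ', framePotW_eq_sum_frameLin L W Y k ((L : ℤ) • z)]
      -- the nested corners: `L^{k−m}•(L•z) = L^{k+1−m}•z` for `m < k`
      have hshift : ∀ m ∈ range k, ((L : ℤ) ^ (k - m)) • ((L : ℤ) • z) = ((L : ℤ) ^ (k + 1 - m)) • z := by
        intro m hm
        have hmk : m < k := Finset.mem_range.mp hm
        rw [smul_smul, ← pow_succ, show k - m + 1 = k + 1 - m by omega]
      have e1 : (((L : ℤ) ^ (k + 1 - k)) • z : Site d) = (L : ℤ) • z := by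
        rw [Nat.add_sub_cancel_left, pow_one]
      rw [Finset.sum_range_succ, e1, add_comm]
      refine congrArg (· + Fbar L (cavgIter L k W) (QbarIter L k W Y) z) ?_
      exact Finset.sum_congr rfl fun m hm => by rw [hshift m hm]

/-! ## §2 The level dictionary in the regime of [Balaban1985Averaging] Prop. 4 -/

/-- `e^{4cα₀} ≤ 2` from the `hsmall` line (its second factor is at least `1`). [folklore] -/
theorem exp_le_two_of_hsmall {d : ℕ} {α₀ t C : ℝ} (hC : 0 ≤ C) (ht : 0 ≤ t)
    (hsmall : Real.exp (4 * (800 * ((d : ℝ) + 1) ^ 2 * ((d : ℝ) + 4)) * α₀) * (1 + 8 * C * t) ≤ 2) :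
    Real.exp (4 * (800 * ((d : ℝ) + 1) ^ 2 * ((d : ℝ) + 4)) * α₀) ≤ 2 := by
  have h1 : 1 ≤ 1 + 8 * C * t := by nlinarith
  have hE : 0 ≤ Real.exp (4 * (800 * ((d : ℝ) + 1) ^ 2 * ((d : ℝ) + 4)) * α₀) := (Real.exp_pos _).le
  nlinarith

/-- **THE LEVEL DICTIONARY IN THE PROP-4 REGIME AT LEVEL `k`** (hypotheses of `B7Eq123General.dbavgCovIter_eq_expCfg_logCovIter` at a unitary `W`, `sup‖X‖ ≤ b`): for every
`m ≤ k`, with `W̄^m := avgIter L W m` and `ψ_m := Ad_{W̄^m}⁻¹ (logCovIter L W (Ad_W X) m)` (bondwise): (i) `W̄^m` is unitary; (ii) `U̿^m = dbavgCovIter L W (relPert W X) m =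
expCfg (Ad_{W̄^m} ψ_m)` (the shape brick 1 consumes); (iii) `ψ_m − QbarIter L m W X = Ad_{W̄^m}⁻¹ (logCovIter_m − linCovIter_m)` bondwise (row NE3's `linCovIter_adField`);
(iv) `‖ψ_m‖ ≤ 2L^m b`; (v) `‖ψ_m − QbarIter L m W X‖ ≤ 16C₁(L^m b)²`, `C₁ = 131072(d+1)²`. [folklore] -/
theorem level_dictionary [Nonempty n] {L : ℕ} (hL : 2 ≤ L) (k : ℕ)
    {W : Site d → Fin d → (Matrix n n ℂ)ˣ} (hWu : IsUnitaryCfg W) {X : Site d → Fin d → Matrix n n ℂ}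
    {α₀ b : ℝ} (hα : 0 < α₀) (hα3 : C0 d * α₀ ≤ 1 / 3) (hα4 : 4 * α₀ ≤ c2' d L)
    (h52 : pdev W < α₀ * (((L : ℝ) ^ k)⁻¹) ^ 2) (hb : 0 ≤ b) (hX : ∀ (y : Site d) (κ : Fin d), ‖X y κ‖ ≤ b)
    (hsmall : Real.exp (4 * (800 * ((d : ℝ) + 1) ^ 2 * ((d : ℝ) + 4)) * α₀)
      * (1 + 8 * (131072 * ((d : ℝ) + 1) ^ 2) * ((L : ℝ) ^ k * b)) ≤ 2)
    (hc₃ : 2 * ((L : ℝ) ^ k * b) ≤ c3 d L) :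
    ∀ m ≤ k,
      IsUnitaryCfg (avgIter L W m) ∧
      dbavgCovIter L W (relPert W X) m
        = expCfg (fun x μ => Ad (avgIter L W m x μ) (Ad (avgIter L W m x μ)⁻¹ (logCovIter L W (adField W X) m x μ))) ∧
      (∀ (x : Site d) (μ : Fin d), Ad (avgIter L W m x μ)⁻¹ (logCovIter L W (adField W X) m x μ) - QbarIter L m W X x μ
        = Ad (avgIter L W m x μ)⁻¹ (logCovIter L W (adField W X) m x μ - linCovIter L W (adField W X) m x μ)) ∧
      (∀ (x : Site d) (μ : Fin d), ‖Ad (avgIter L W m x μ)⁻¹ (logCovIter L W (adField W X) m x μ)‖ ≤ 2 * ((L : ℝ) ^ m * b)) ∧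
      (∀ (x : Site d) (μ : Fin d), ‖Ad (avgIter L W m x μ)⁻¹ (logCovIter L W (adField W X) m x μ) - QbarIter L m W X x μ‖
        ≤ 16 * (131072 * ((d : ℝ) + 1) ^ 2) * ((L : ℝ) ^ m * b) ^ 2) := by
  letI : CStarAlgebra (Matrix n n ℂ) := {}
  have hL1 : 1 ≤ L := by omega
  have hG := avgClosed_unitaryUnits d (𝔸 := Matrix n n ℂ) L
  have hU₀ : ∀ (y : Site d) (κ : Fin d), W y κ ∈ unitaryUnits (Matrix n n ℂ) := hWu
  have hBsup : ∀ (y : Site d) (κ : Fin d), ‖adField W X y κ‖ ≤ b := fun y κ => by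
    unfold adField; rw [norm_Ad_of_unitary (hWu y κ)]; exact hX y κ
  have h4 := prop4_general L hL hG k W hU₀ hα hα3 hα4 h52 (adField W X) hb hBsup hsmall hc₃
  have hld := level_data L hL hG k W hU₀ hα hα3 hα4 h52
  have hreg := B7Prop4GeneralLevels.level_regularity L hL hG k W hU₀ hα hα3 (by linarith) h52
  have hQ := dbavgCovIter_eq_expCfg_logCovIter L hL hG k W hU₀ hα hα3 hα4 h52 (adField W X) hb hBsup hsmall hc₃
  have hexp : Real.exp (4 * (800 * ((d : ℝ) + 1) ^ 2 * ((d : ℝ) + 4)) * α₀) ≤ 2 :=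
    exp_le_two_of_hsmall (C := 131072 * ((d : ℝ) + 1) ^ 2) (by positivity) (by positivity) hsmall
  -- loops of every averaged background below the top (for row NE3's dictionary)
  have hloopsW : ∀ i < k, ∀ (z : Site d) (κ : Fin d) (r : Fin d → Fin L),
      ‖((Wcx L (cavgIter L i W) ((L : ℤ) • z) κ (boxVec L r) : (Matrix n n ℂ)ˣ) : Matrix n n ℂ) - 1‖ < 1 := by
    intro i hi z κ r
    obtain ⟨hV, hβ0, hβ, hβmax⟩ := hld i hi.le
    rw [cavgIter_eq_avgIter]
    have h := blockLoops_of_pdev hL1 hV hβ0 hβ hβmax ((L : ℤ) • z) κ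
    exact ((h.1 r).trans h.2).trans_lt (by norm_num)
  intro m hm
  have hUm : IsUnitaryCfg (avgIter L W m) := (hreg m hm).2
  have hdict : linCovIter L W (adField W X) m = adField (cavgIter L m W) (QbarIter L m W X) :=
    linCovIter_adField L W X m (fun i hi => hloopsW i (lt_of_lt_of_le hi hm))
  refine ⟨hUm, ?_, ?_, ?_, ?_⟩
  · -- (ii) `U̿^m = expCfg (logCovIter_m)` and `Ad ∘ Ad⁻¹ = id`
    have e : (fun x μ => Ad (avgIter L W m x μ) (Ad (avgIter L W m x μ)⁻¹ (logCovIter L W (adField W X) m x μ)))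
        = logCovIter L W (adField W X) m := by
      funext x μ; rw [Ad_Ad_inv]
    rw [e, relPert_eq_expCfg_adField]
    exact hQ m hm
  · -- (iii) the Prop-4 remainder, conjugated to the end frame
    intro x μ
    have hlin : linCovIter L W (adField W X) m x μ = Ad (cavgIter L m W x μ) (QbarIter L m W X x μ) := by
      rw [hdict]; rfl
    rw [hlin, cavgIter_eq_avgIter, Ad_sub, ← Ad_mul, inv_mul_cancel, Ad_one]
  · -- (iv) sup of the level field
    intro x μ
    rw [norm_Ad_of_unitary (Subgroup.inv_mem _ (hUm x μ))]
    exact (h4 m hm).2 x μ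
  · -- (v) sup of the remainder
    intro x μ
    have hlin : linCovIter L W (adField W X) m x μ = Ad (cavgIter L m W x μ) (QbarIter L m W X x μ) := by
      rw [hdict]; rfl
    have e : Ad (avgIter L W m x μ)⁻¹ (logCovIter L W (adField W X) m x μ) - QbarIter L m W X x μ
        = Ad (avgIter L W m x μ)⁻¹ (logCovIter L W (adField W X) m x μ - linCovIter L W (adField W X) m x μ) := by
      rw [hlin, cavgIter_eq_avgIter, Ad_sub, ← Ad_mul, inv_mul_cancel, Ad_one]
    rw [e, norm_Ad_of_unitary (Subgroup.inv_mem _ (hUm x μ))]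
    refine ((h4 m hm).1 x μ).trans ?_
    have h0 : 0 ≤ ((L : ℝ) ^ m * b) ^ 2 := sq_nonneg _
    have hC : 0 ≤ 8 * (131072 * ((d : ℝ) + 1) ^ 2) := by positivity
    calc 8 * (131072 * ((d : ℝ) + 1) ^ 2) * Real.exp (4 * (800 * ((d : ℝ) + 1) ^ 2 * ((d : ℝ) + 4)) * α₀) * ((L : ℝ) ^ m * b) ^ 2
        ≤ 8 * (131072 * ((d : ℝ) + 1) ^ 2) * 2 * ((L : ℝ) ^ m * b) ^ 2 :=
          mul_le_mul_of_nonneg_right (mul_le_mul_of_nonneg_left hexp hC) h0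
      _ = 16 * (131072 * ((d : ℝ) + 1) ^ 2) * ((L : ℝ) ^ m * b) ^ 2 := by ring

end

end Summit.QuantumFields.BalabanUV.T4Continuum.NE7AccumulatedFrameDictionary
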